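import Literature.RingTheory.FormalGroups.FormalGroupHom
import Mathlib.RingTheory.PowerSeries.Trunc
import Mathlib.RingTheory.PowerSeries.Order
import Mathlib.RingTheory.Nilpotent.Basic
import HarnessLib

/-!
# Evaluation of power series at NILPOTENT elements (`evalNilp`, `evalNilp₂`)
# ([Bourbaki, Algebra II] Ch. IV §4 no. 3; P6d lines `F0_P6d_LubinTateFormalModuli` §2⅝ ∕ `F0_P6d_FormalModuleKernels` :90)

Topic `Literature/RingTheory/FormalGroups`; namespace `Literature.RingTheory.FormalGroups`.  DEFINITIONS + fully proved theorems; no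
named fact, no instance, no notation, no `sorry`.  Cell `hodgecm-mathlib`, P6 «MOD programme» ROW 4B — the POINTS CURRENCY of desk
F0P6d-plan (g0)'s lines (`TorsPts F p n R = {x ∈ Nil R ∣ [pⁿ]_F x = 0}`, letter (HL-C) `KernelPointsOfHeight`): the desk's inline
`evalNilp` ∕ `evalNilp₂` TEXTS are reproduced VERBATIM (same `Nat.find` normal form, so the lines' statements match by unfolding) and given
their algebra.  NO topology is used (contrast ★ `GaloisRepresentations/LubinTatePoints.evalPt` = Mathlib `aeval` on a closed nil IDEAL of a
complete linearly topologised algebra); here `x` is ONE nilpotent element of an arbitrary commutative `A`-algebra `R` and every sum is finite.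

## Contents

* `evalNilp f x` (`= Σ_{i<N} fᵢ xⁱ` for any `N` with `x^N = 0`; junk `0` at non-nilpotent `x`), `evalNilp₂ F x y` (two variables).
* witness independence `evalNilp_eq_sum`; `evalNilp_eq_aeval_trunc` (`= Polynomial.aeval x (trunc N f)`).
* ring-homomorphism identities at a nilpotent `x`: `evalNilp_add`, `evalNilp_mul` (via Mathlib `trunc_trunc_mul_trunc`), `evalNilp_pow`,
  `evalNilp_C`, `evalNilp_X`, `evalNilp_one`, `evalNilp_zero`, `evalNilp_smul`; `evalNilp_X_pow_mul` (`(X^N·w)(x) = x^N · w(x)`).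
* values: `isNilpotent_evalNilp` (`f(0) = 0 ⇒ f(x)` nilpotent, indeed `f(x)^N = 0` when `x^N = 0`), `isUnit_evalNilp` (`f(0) ∈ Aˣ ⇒ f(x) ∈ Rˣ`).
* **composition** `evalNilp_subst : (ψ(φ))(x) = ψ(φ(x))` for `φ(0) = 0`, and its `FormalGroupHom` form `evalNilp_comp : (ψ ∘ φ)(x) = ψ(φ(x))`.
-/

noncomputable section

namespace Literature.RingTheory.FormalGroups

open Finset

universe u v

/-! ## §0 The two definitions (texts of the P6d lines, verbatim) -/

open Classical in
/-- Evaluation of a one-variable power series over `A` at a NILPOTENT element `x` of an `A`-algebra `R`: the finite sum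
`∑_{i<N} fᵢ xⁱ` (`x^N = 0`; independent of the witness `N`), junk value `0` at a non-nilpotent `x`.
[cite: BourbakiAlgebraII2003, Ch. IV §4 no. 3] -/
def evalNilp {A : Type u} [CommRing A] {R : Type v} [CommRing R] [Algebra A R] (f : PowerSeries A) (x : R) : R :=
  if hx : IsNilpotent x then
    ∑ i ∈ Finset.range (Nat.find hx), algebraMap A R (PowerSeries.coeff i f) * x ^ i
  else 0

open Classical in
/-- Evaluation of a two-variable power series over `A` at a pair of NILPOTENT elements of an `A`-algebra `R` (finite
double sum; junk value `0` otherwise) — used for `F(x, y)`, the `F`-addition of nilpotent points.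
[cite: BourbakiAlgebraII2003, Ch. IV §4 no. 3] -/
def evalNilp₂ {A : Type u} [CommRing A] {R : Type v} [CommRing R] [Algebra A R] (F : MvPowerSeries (Fin 2) A) (x y : R) : R :=
  if hxy : IsNilpotent x ∧ IsNilpotent y then
    ∑ i ∈ Finset.range (Nat.find hxy.1), ∑ j ∈ Finset.range (Nat.find hxy.2),
      algebraMap A R (MvPowerSeries.coeff (Finsupp.single 0 i + Finsupp.single 1 j) F) * x ^ i * y ^ j
  else 0

variable {A : Type u} [CommRing A] {R : Type v} [CommRing R] [Algebra A R]

/-! ## §1 Witness independence -/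

/-- Terms beyond a nilpotency witness vanish: `Σ_{i<M} cᵢ xⁱ = Σ_{i<N} cᵢ xⁱ` when `x^N = 0`, `N ≤ M`. [cite: BourbakiAlgebraII2003, Ch. IV §4 no. 3] -/
theorem sum_range_eq_sum_range_of_pow_eq_zero {x : R} {N M : ℕ} (hx : x ^ N = 0) (hNM : N ≤ M) (c : ℕ → A) :
    ∑ i ∈ range M, algebraMap A R (c i) * x ^ i = ∑ i ∈ range N, algebraMap A R (c i) * x ^ i := by
  obtain ⟨k, rfl⟩ := Nat.exists_eq_add_of_le hNM
  rw [Finset.sum_range_add, add_eq_left]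
  refine Finset.sum_eq_zero fun i _ => ?_
  rw [pow_add, hx, zero_mul, mul_zero]

open Classical in
/-- **`evalNilp f x = Σ_{i<N} fᵢ xⁱ` for ANY `N` with `x^N = 0`.** [cite: BourbakiAlgebraII2003, Ch. IV §4 no. 3] -/
theorem evalNilp_eq_sum (f : PowerSeries A) {x : R} {N : ℕ} (hx : x ^ N = 0) :
    evalNilp f x = ∑ i ∈ range N, algebraMap A R (PowerSeries.coeff i f) * x ^ i := by
  have hnil : IsNilpotent x := ⟨N, hx⟩
  rw [evalNilp, dif_pos hnil, ← sum_range_eq_sum_range_of_pow_eq_zero (Nat.find_spec hnil) (Nat.find_min' hnil hx)]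

open Classical in
/-- Junk value: `evalNilp f x = 0` at a non-nilpotent `x`. [cite: BourbakiAlgebraII2003, Ch. IV §4 no. 3] -/
theorem evalNilp_of_not_isNilpotent (f : PowerSeries A) {x : R} (hx : ¬ IsNilpotent x) : evalNilp f x = 0 := by
  rw [evalNilp, dif_neg hx]

/-- `evalNilp f x = aeval x (trunc N f)` for any witness `x^N = 0` (Mathlib `eval₂_trunc_eq_sum_range`). [cite: BourbakiAlgebraII2003, Ch. IV §4 no. 3] -/
theorem evalNilp_eq_aeval_trunc (f : PowerSeries A) {x : R} {N : ℕ} (hx : x ^ N = 0) :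
    evalNilp f x = Polynomial.aeval x (PowerSeries.trunc N f) := by
  rw [evalNilp_eq_sum f hx, Polynomial.aeval_def, PowerSeries.eval₂_trunc_eq_sum_range]

/-- A POLYNOMIAL evaluated at `x` with `x^N = 0` only sees its truncation below `N`. [cite: BourbakiAlgebraII2003, Ch. IV §4 no. 3] -/
theorem aeval_eq_aeval_trunc_coe {x : R} {N : ℕ} (hx : x ^ N = 0) (P : Polynomial A) :
    Polynomial.aeval x P = Polynomial.aeval x (PowerSeries.trunc N (P : PowerSeries A)) := by
  rw [Polynomial.aeval_def _ (PowerSeries.trunc N _), PowerSeries.eval₂_trunc_eq_sum_range,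
    Polynomial.aeval_eq_sum_range' (n := N + (P.natDegree + 1)) (by omega)]
  simp_rw [Algebra.smul_def, Polynomial.coeff_coe]
  exact sum_range_eq_sum_range_of_pow_eq_zero hx (Nat.le_add_right N _) _

/-! ## §2 Ring-homomorphism identities at a nilpotent element -/

/-- `evalNilp 0 x = 0`. [cite: BourbakiAlgebraII2003, Ch. IV §4 no. 3] -/
@[simp] theorem evalNilp_zero (x : R) : evalNilp (0 : PowerSeries A) x = 0 := by
  by_cases hx : IsNilpotent x
  · obtain ⟨N, hN⟩ := hx; simp [evalNilp_eq_sum 0 hN]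
  · exact evalNilp_of_not_isNilpotent 0 hx

/-- Additivity: `(f + g)(x) = f(x) + g(x)`. [cite: BourbakiAlgebraII2003, Ch. IV §4 no. 3] -/
theorem evalNilp_add (f g : PowerSeries A) (x : R) : evalNilp (f + g) x = evalNilp f x + evalNilp g x := by
  by_cases hx : IsNilpotent x
  · obtain ⟨N, hN⟩ := hx
    simp only [evalNilp_eq_sum _ hN, map_add, add_mul, Finset.sum_add_distrib]
  · simp [evalNilp_of_not_isNilpotent _ hx]

/-- **Multiplicativity: `(f·g)(x) = f(x)·g(x)`** (Cauchy product below a nilpotency witness; Mathlib `trunc_trunc_mul_trunc`).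
[cite: BourbakiAlgebraII2003, Ch. IV §4 no. 3] -/
theorem evalNilp_mul (f g : PowerSeries A) (x : R) : evalNilp (f * g) x = evalNilp f x * evalNilp g x := by
  by_cases hx : IsNilpotent x
  · obtain ⟨N, hN⟩ := hx
    rw [evalNilp_eq_aeval_trunc _ hN, evalNilp_eq_aeval_trunc _ hN, evalNilp_eq_aeval_trunc _ hN, ← map_mul,
      aeval_eq_aeval_trunc_coe hN (PowerSeries.trunc N f * PowerSeries.trunc N g), Polynomial.coe_mul,
      PowerSeries.trunc_trunc_mul_trunc]
  · simp [evalNilp_of_not_isNilpotent _ hx]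

/-- Constants: `(C a)(x) = a`, at a nilpotent `x`. [cite: BourbakiAlgebraII2003, Ch. IV §4 no. 3] -/
theorem evalNilp_C {x : R} (hx : IsNilpotent x) (a : A) : evalNilp (PowerSeries.C a) x = algebraMap A R a := by
  obtain ⟨N, hN⟩ := hx
  have hN1 : x ^ (N + 1) = 0 := by rw [pow_succ, hN, zero_mul]
  rw [evalNilp_eq_sum _ hN1, Finset.sum_eq_single 0 (fun i _ hi => by rw [PowerSeries.coeff_C, if_neg hi, map_zero, zero_mul])
    (fun h => absurd (Finset.mem_range.mpr (Nat.succ_pos N)) h)]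
  simp

/-- `1(x) = 1` at a nilpotent `x`. [cite: BourbakiAlgebraII2003, Ch. IV §4 no. 3] -/
theorem evalNilp_one {x : R} (hx : IsNilpotent x) : evalNilp (1 : PowerSeries A) x = 1 := by
  rw [← map_one PowerSeries.C, evalNilp_C hx, map_one]

/-- `A`-linearity: `(a • f)(x) = a • f(x)`. [cite: BourbakiAlgebraII2003, Ch. IV §4 no. 3] -/
theorem evalNilp_smul (a : A) (f : PowerSeries A) (x : R) : evalNilp (a • f) x = a • evalNilp f x := by
  by_cases hx : IsNilpotent x
  · rw [PowerSeries.smul_eq_C_mul, evalNilp_mul, evalNilp_C hx, Algebra.smul_def]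
  · simp [evalNilp_of_not_isNilpotent _ hx]

/-- The variable: `X(x) = x` at a nilpotent `x`. [cite: BourbakiAlgebraII2003, Ch. IV §4 no. 3] -/
theorem evalNilp_X {x : R} (hx : IsNilpotent x) : evalNilp (PowerSeries.X : PowerSeries A) x = x := by
  obtain ⟨N, hN⟩ := hx
  have hN2 : x ^ (N + 2) = 0 := by rw [pow_add, hN, zero_mul]
  rw [evalNilp_eq_sum _ hN2, Finset.sum_eq_single 1 (fun i _ hi => by rw [PowerSeries.coeff_X, if_neg hi, map_zero, zero_mul])
    (fun h => absurd (Finset.mem_range.mpr (by omega)) h)]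
  simp

/-- Powers: `(f^n)(x) = f(x)^n` at a nilpotent `x`. [cite: BourbakiAlgebraII2003, Ch. IV §4 no. 3] -/
theorem evalNilp_pow {x : R} (hx : IsNilpotent x) (f : PowerSeries A) (n : ℕ) : evalNilp (f ^ n) x = evalNilp f x ^ n := by
  induction n with
  | zero => rw [pow_zero, pow_zero, evalNilp_one hx]
  | succ n ih => rw [pow_succ, pow_succ, evalNilp_mul, ih]

/-- `(X^N · w)(x) = x^N · w(x)`. [cite: BourbakiAlgebraII2003, Ch. IV §4 no. 3] -/
theorem evalNilp_X_pow_mul {x : R} (hx : IsNilpotent x) (N : ℕ) (w : PowerSeries A) :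
    evalNilp ((PowerSeries.X : PowerSeries A) ^ N * w) x = x ^ N * evalNilp w x := by
  rw [evalNilp_mul, evalNilp_pow hx, evalNilp_X hx]

/-! ## §3 Values: nilpotent for `f(0) = 0`, a unit for `f(0)` a unit -/

/-- `f(0) = 0`, `x^N = 0` ⇒ `f(x)^N = 0` (`f = X·f′`, `f(x) = x·f′(x)`). [cite: BourbakiAlgebraII2003, Ch. IV §4 no. 3] -/
theorem evalNilp_pow_eq_zero {f : PowerSeries A} (hf : PowerSeries.constantCoeff f = 0) {x : R} {N : ℕ} (hx : x ^ N = 0) :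
    evalNilp f x ^ N = 0 := by
  obtain ⟨f', rfl⟩ : PowerSeries.X ∣ f := PowerSeries.X_dvd_iff.mpr hf
  rw [evalNilp_mul, evalNilp_X ⟨N, hx⟩, mul_pow, hx, zero_mul]

/-- `f(0) = 0` ⇒ `f(x)` is nilpotent (for every `x`; junk `0` at non-nilpotent `x`). [cite: BourbakiAlgebraII2003, Ch. IV §4 no. 3] -/
theorem isNilpotent_evalNilp {f : PowerSeries A} (hf : PowerSeries.constantCoeff f = 0) (x : R) : IsNilpotent (evalNilp f x) := by
  by_cases hx : IsNilpotent x
  · obtain ⟨N, hN⟩ := hx; exact ⟨N, evalNilp_pow_eq_zero hf hN⟩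
  · rw [evalNilp_of_not_isNilpotent _ hx]; exact IsNilpotent.zero

/-- Splitting off the constant term: `f(x) = f(0) + (f − f(0))(x)` with the second summand nilpotent. [cite: BourbakiAlgebraII2003, Ch. IV §4 no. 3] -/
theorem evalNilp_eq_algebraMap_add {x : R} (hx : IsNilpotent x) (f : PowerSeries A) :
    evalNilp f x = algebraMap A R (PowerSeries.constantCoeff f) + evalNilp (f - PowerSeries.C (PowerSeries.constantCoeff f)) x := by
  conv_lhs => rw [show f = PowerSeries.C (PowerSeries.constantCoeff f) + (f - PowerSeries.C (PowerSeries.constantCoeff f)) by ring]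
  rw [evalNilp_add, evalNilp_C hx]

/-- **`f(0) ∈ Aˣ` ⇒ `f(x) ∈ Rˣ`** at a nilpotent `x` (unit + nilpotent). [cite: BourbakiAlgebraII2003, Ch. IV §4 no. 4] -/
theorem isUnit_evalNilp {x : R} (hx : IsNilpotent x) {f : PowerSeries A} (hf : IsUnit (PowerSeries.constantCoeff f)) :
    IsUnit (evalNilp f x) := by
  rw [evalNilp_eq_algebraMap_add hx]
  exact (isNilpotent_evalNilp (by simp) x).isUnit_add_left_of_commute (hf.map _) (Commute.all _ _)

/-! ## §4 Composition -/

/-- Coefficients of `ψ(φ)` below `N` as a FINITE sum: `(ψ(φ))ₙ = Σ_{d<N} ψ_d (φ^d)ₙ` for `n < N`, `φ(0) = 0` (the terms `d > n` vanish since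
`ord(φ^d) ≥ d`). [cite: BourbakiAlgebraII2003, Ch. IV §4 no. 3] -/
theorem coeff_subst_eq_sum_of_lt {φ : PowerSeries A} (hφ : PowerSeries.constantCoeff φ = 0) (ψ : PowerSeries A) {n N : ℕ} (hn : n < N) :
    PowerSeries.coeff n (PowerSeries.subst φ ψ) = ∑ d ∈ range N, PowerSeries.coeff d ψ * PowerSeries.coeff n (φ ^ d) := by
  classical
  have hφs : PowerSeries.HasSubst φ := PowerSeries.HasSubst.of_constantCoeff_zero' hφ
  have hvan : ∀ d, N ≤ d → PowerSeries.coeff n (φ ^ d) = 0 := fun d hd =>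
    PowerSeries.coeff_of_lt_order n (lt_of_lt_of_le (by exact_mod_cast lt_of_lt_of_le hn hd)
      (PowerSeries.le_order_pow_of_constantCoeff_eq_zero d hφ))
  rw [PowerSeries.coeff_subst' hφs, finsum_eq_sum_of_support_subset _ (s := range N)]
  · simp [smul_eq_mul]
  · intro d hd
    simp only [Function.mem_support, ne_eq, Finset.coe_range, Set.mem_Iio] at hd ⊢
    by_contra h
    exact hd (by rw [hvan d (not_lt.mp h), smul_zero])

/-- **Evaluation commutes with substitution: `(ψ(φ))(x) = ψ(φ(x))`** for `φ(0) = 0` and nilpotent `x`.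
[cite: BourbakiAlgebraII2003, Ch. IV §4 no. 3] -/
theorem evalNilp_subst {φ : PowerSeries A} (hφ : PowerSeries.constantCoeff φ = 0) (ψ : PowerSeries A) {x : R} (hx : IsNilpotent x) :
    evalNilp (PowerSeries.subst φ ψ) x = evalNilp ψ (evalNilp φ x) := by
  obtain ⟨N, hN⟩ := hx
  have hy : evalNilp φ x ^ N = 0 := evalNilp_pow_eq_zero hφ hN
  rw [evalNilp_eq_sum ψ hy, evalNilp_eq_sum _ hN]
  simp_rw [← evalNilp_pow ⟨N, hN⟩ φ, evalNilp_eq_sum _ hN, Finset.mul_sum]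
  rw [Finset.sum_comm]
  refine Finset.sum_congr rfl fun n hn => ?_
  rw [coeff_subst_eq_sum_of_lt hφ ψ (Finset.mem_range.mp hn), map_sum, Finset.sum_mul]
  refine Finset.sum_congr rfl fun d _ => ?_
  rw [map_mul, mul_assoc]

/-- **Homomorphisms of formal group laws compose on nilpotent points: `(ψ ∘ φ)(x) = ψ(φ(x))`.** [cite: Hazewinkel1978, §1.2 Def. (1.2.1)] -/
theorem evalNilp_comp {F G H : FormalGroup A} (ψ : FormalGroupHom G H) (φ : FormalGroupHom F G) {x : R} (hx : IsNilpotent x) :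
    evalNilp (ψ.comp φ).toPowerSeries x = evalNilp ψ.toPowerSeries (evalNilp φ.toPowerSeries x) := by
  rw [FormalGroupHom.comp_toPowerSeries, evalNilp_subst φ.constantCoeff_eq_zero ψ.toPowerSeries hx]

/-! ## §5 Two variables: witness independence -/

open Classical in
/-- `evalNilp₂ F x y = Σ_{i<N} Σ_{j<M} F_{ij} xⁱ yʲ` for ANY witnesses `x^N = 0`, `y^M = 0`. [cite: BourbakiAlgebraII2003, Ch. IV §4 no. 3] -/
theorem evalNilp₂_eq_sum (F : MvPowerSeries (Fin 2) A) {x y : R} {N M : ℕ} (hx : x ^ N = 0) (hy : y ^ M = 0) :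
    evalNilp₂ F x y = ∑ i ∈ range N, ∑ j ∈ range M,
      algebraMap A R (MvPowerSeries.coeff (Finsupp.single 0 i + Finsupp.single 1 j) F) * x ^ i * y ^ j := by
  have hnil : IsNilpotent x ∧ IsNilpotent y := ⟨⟨N, hx⟩, ⟨M, hy⟩⟩
  rw [evalNilp₂, dif_pos hnil]
  -- inner sums: witness `M` vs `Nat.find`
  have hinner : ∀ i, (∑ j ∈ range (Nat.find hnil.2),
      algebraMap A R (MvPowerSeries.coeff (Finsupp.single 0 i + Finsupp.single 1 j) F) * x ^ i * y ^ j) =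
      ∑ j ∈ range M, algebraMap A R (MvPowerSeries.coeff (Finsupp.single 0 i + Finsupp.single 1 j) F) * x ^ i * y ^ j := by
    intro i
    have key := fun (K : ℕ) => (Finset.sum_congr rfl fun j (_ : j ∈ range K) =>
      (mul_right_comm (algebraMap A R (MvPowerSeries.coeff (Finsupp.single 0 i + Finsupp.single 1 j) F)) (x ^ i) (y ^ j)))
    rw [key, key, ← Finset.sum_mul, ← Finset.sum_mul,
      ← sum_range_eq_sum_range_of_pow_eq_zero (Nat.find_spec hnil.2) (Nat.find_min' hnil.2 hy)]
  simp_rw [hinner]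
  -- outer sum: witness `N` vs `Nat.find`
  have houter : ∀ K : ℕ, (∑ i ∈ range K, ∑ j ∈ range M,
      algebraMap A R (MvPowerSeries.coeff (Finsupp.single 0 i + Finsupp.single 1 j) F) * x ^ i * y ^ j) =
      ∑ j ∈ range M, (∑ i ∈ range K, algebraMap A R (MvPowerSeries.coeff (Finsupp.single 0 i + Finsupp.single 1 j) F) * x ^ i) * y ^ j := by
    intro K; rw [Finset.sum_comm]; simp_rw [Finset.sum_mul]
  rw [houter, houter]
  refine Finset.sum_congr rfl fun j _ => ?_
  rw [← sum_range_eq_sum_range_of_pow_eq_zero (Nat.find_spec hnil.1) (Nat.find_min' hnil.1 hx)]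

open Classical in
/-- Junk value of `evalNilp₂`. [cite: BourbakiAlgebraII2003, Ch. IV §4 no. 3] -/
theorem evalNilp₂_of_not {F : MvPowerSeries (Fin 2) A} {x y : R} (h : ¬ (IsNilpotent x ∧ IsNilpotent y)) : evalNilp₂ F x y = 0 := by
  rw [evalNilp₂, dif_neg h]

end Literature.RingTheory.FormalGroups
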